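import Summits.BirchSwinnertonDyer.Rank1Residual.O6.X4SelmerRigidityCertificate
import Literature.NumberTheory.EllipticCurves.Rank1Residual.Typed.KolyvaginCertificate
import HarnessLib

/-!
# O6 / X4 ∧ ¬(12.5.2), rank 0: the `t = 0` and TWO-PLACE Selmer rigidity certificates (T-X4E-rig-0, T-X4E-rig-q), the certificate
# INSTANCES for the `t = 1` targets (EVIDENCE), and the certificates read in the cell's currency (PROVED bookkeeping)
(cell `b2b-bsdres`, lane CLASS-CLOSURE, class O6 §3.4 ∩ X4; planner o6-r1 GEN 22 ADDENDA 4 / 6 / 7 — memo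
 `HOME/b2b-bsdres-o6-r1/gen22/O6-GEN22.md`, typed sketch FROZEN as `gen23/lean/O6X3KatoMember.lean` (sha256 `1ebe8b840718b67c…`,
 1 102 l., `SHA256SUMS.gen23`) §X4E-rig l.992–1096; docket cc-lead ⟦gen60⟧/⟦gen61⟧ (2′)(iv) (c25), conditions (A)–(G); typer of record
 cc-typer-5 GEN 16; FOURTH `O6/X4…` sibling, split from `O6/X4SelmerRigidityCertificate.lean` for `lint.size`; decl blocks
 byte-identical to the frozen sketch; §Readings = the typer's PROVED bookkeeping; 0 Literature facts.)

HONEST FRAMING (cell `b2b-bsdres`, run/shared/lean/b2b/bsd-rank1-residual/, verbatim in every file): the goal of the cell is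
to DELETE the COMBINATION-SHAPED residual classes of the Birch–Swinnerton-Dyer formula for ALL analytic-rank `≤ 1` elliptic
curves over `ℚ` — "full BSD formula for every rank `≤ 1` curve in class `C`" assembled STRICTLY from published theorems — so that
the rank-`≤ 1` remainder becomes exactly the CONSTRUCTION-SHAPED classes, which are TYPED (missing-input `Prop`s), NOT attempted.
This is not "finishing BSD". Lane CLASS-CLOSURE: research routes; census output is EVIDENCE / conjecture items, never a Literature
fact; no main conjecture inside any certificate; nothing is booked; no mark of `RESIDUAL-MAP.md` moves; O6 and X4 stay OPEN.

WHAT IS TYPED (bodies verbatim from the frozen sketch; section / instance texts = the planner's, verbatim):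
**`@[conjecture] SelmerRigidityCertificateZero` (T-X4E-rig-0, ADDENDUM 6)**, **`@[conjecture] SelmerRigidityCertificateTwoPlace`
(T-X4E-rig-q, ADDENDUM 7)** — EVIDENCE-labelled THEOREM-CANDIDATES ('elementary given the inputs named; NOT in print as stated');
the INSTANCE RECORDS `curve2880r5`, `curve77760s1`, `curve14400eb1`, `curve43200ff1` (curve `def`s = DATA, with the planner's
certificate-data text: kit j160739 / j160943 / j161046 / j161047 / j161254; census-lead GEN 25 l.11753 / l.11817: **C-rig-2 SERVED**
(the four displayed points on `43200ff1` / `77760s1` on-curve 4/4 = Cremona `allgens`, rank 2, saturated), **C-rig0 j161347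
RE-TALLIED = memo** (80 pairs / 69 RIG0-OK / 11 EXCLUDED / 16 of 18 targets with ≥ 2 OK anchors), **C-rig-1 / C-rig-3 PENDING** —
predictions REGISTERED (ρ(14400eb1, −191) = 16 ⇒ 3 ∤ I_K; flex types La / La / Lur / Lb), independent `--tool pari` run staged by
cc-eng-5 GEN 39 (`class-closure/eng-5/crig-g39/`, rider (G)); words update only from census-lead's line).  AUDIT WORDS OF RECORD:
**lit-kato AUD-20 (i)–(v) PASS ×5 (GEN 38, `gen38/AUD-20-gen38.md` 66fcbf56fe5ee12d → 761454cf8cd73eda); typed certificate FAITHFUL;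
(vi) T-X4E-rig-q PRE-READ pass-shaped**; the Manin constant `c = 1` (Cremona, optimal curves `N < 130 000`, [AgasheRibetStein2006] via
[Miller2011LMS] §4 ¶1) is LOAD-BEARING for `14400eb1` (`9 ∣ 14400`) — AUD-20 (iii); Miller's Thm. 4.2 / Cor. 4.3 / Thm. 4.4 carry no
`p ∤ N`; 3-parity = Dokchitser–Dokchitser, Ann. of Math. 172 (2010) Thm. 1.4 (= arXiv:math/0610290 §4.6 Thm. 52).
NO decl below asserts `BSD(E, 3)` or `Ш(E)[3] = 0` for a named curve hypothesis-free: the per-curve conclusions appear ONLY as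
theorems FROM the displayed certificate binders (§Readings; the (c9) / READINGS precedent); '18 / 20 Elkies-corner pairs
certificate-complete modulo audit' is the planner's EVIDENCE sentence, never a `RESIDUAL-MAP.md` count (O6 OPEN; marks are the
referee's).  §Readings (PROVED, typer): the certificates' common conclusion `rank W(ℚ) = 0 ∧ Ш(W)[3] = 0` in the cell's currency
at a pair with `3 ∤ #Ш_an(W)` — `MissingPPartAt W 3` (finite `Ш`) and Miller's `BSDp W 3` granted GZK (`hGZK`, bsd.S17) — over the
tree's `Typed.missingPPartAt_of_shaAn_unit_of_noPTorsion` / `Typed.bsdp_of_shaAn_unit_of_noPTorsion`; plus the exact on-curve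
arithmetic of the six displayed rational points (C-rig-2's 'on-curve 4/4' and the two Kolyvagin generators) by `norm_num`.
DEDUP (`lean search`, 2026-08-22): none of the new names exists; reused by name (import): everything of
`O6/X4SelmerRigidityCertificate.lean`, `ModPCongruent`, `torsionPoints`, `MissingPPartAt`, `BSDp`, `shaAn`, `ShaFinite`.
PRESEARCH (typer): as in the sibling — `presearch: SelmerRigidityCertificateZero / …TwoPlace → none beyond the cited antecedents
(corpus + galaxy)`.
References: B. Poonen, E. Rains, J. Amer. Math. Soc. 25 (2012) [PoonenRains2012]; T. Dokchitser, V. Dokchitser, Ann. of Math. 172 (2010)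
Thm. 1.4 [DokchitserDokchitserAnnals2010]; R. L. Miller, LMS J. Comput. Math. 14 (2011) Thm. 1.2, Thm. 4.1, Thm. 4.4, §4 ¶1, §1 Def. 1.1
[Miller2011LMS]; A. Agashe, K. Ribet, W. Stein, Pure Appl. Math. Q. 2 (2006) §2 [AgasheRibetStein2006]; T. Fisher, Math. Z. 271 (2012)
Thm. 1.1 [Fisher2012Hessian]; B. H. Gross, in L-functions and Arithmetic (1991) [Gross1991]; J. H. Silverman, AEC [SilvermanAEC2009];
H. Darmon, CBMS 101 (2004) Thm. 3.22 [Darmon2004].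
-/

set_option autoImplicit false

noncomputable section

open scoped Classical

open WeierstrassCurve Literature.NumberTheory.EllipticCurves
  Literature.NumberTheory.EllipticCurves.Rank1Residual
  Literature.NumberTheory.EllipticCurves.Rank1Residual.Typed
  Summit.BirchSwinnertonDyer.Rank1Residual.Additive

namespace Summit.BirchSwinnertonDyer.Rank1Residual.O6

/-! ## X4E-rig (continued from `O6/X4SelmerRigidityCertificate.lean`): the `t = 0` and two-place certificates (o6-r1 GEN 22
ADDENDA 6 / 7; bodies verbatim) -/

section X4Erig

/-- EVIDENCE: **theorem-candidate (elementary given the inputs named; o6-r1 GEN 22 ADDENDUM 6; NOT in print as stated;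
not reviewed — audit AUD-20 (v))** — **(T-X4E-rig-0) the `t = 0` SELMER RIGIDITY CERTIFICATE.**  When the target has
NO `ℚ₃`-rational 3-torsion, `H¹(ℚ₃, W[3])` is a hyperbolic PLANE, every Kummer condition `κ₃(·)` is an isotropic
LINE, and the global image `V` of (V-rig) is isotropic, hence `dim V ≤ 1`.  If a Tamagawa-trivial congruent member
`W₃` has `Sel₃(W₃) ↪ H¹(ℚ₃)` injective — a rank-zero member with `Ш(W₃)[3] = 0` (e.g. a CERTIFIED KATO UNIT ANCHOR of
C-X4E-0, for which the tree's audited A161″ bound gives `Ш[3] = 0` AND `3 ∤ ∏ c_ℓ` from the unit `L`-value), or a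
rank-one Kolyvagin member with a 3-adically indivisible generator — then `S_str = 0` and `dim Sel₃(W) ≤ 1`; since
`W(ℚ)[3] = 0`, `dim_𝔽₃ Sel₃(W) ≡ corank Sel_{3^∞}(W) ≡ r_an(W) (mod 2)` (Cassels–Tate: the finite part of `Ш[3^∞]`
carries a non-degenerate alternating pairing, so its 3-torsion has even dimension; 3-parity over `ℚ`
[cite: DokchitserDokchitserAnnals2010, Thm. 1.4]), and `w(W) = +1` forces `Sel₃(W) = 0`: `rank W(ℚ) = 0` and
`Ш(W)[3^∞] = 0` — with NO second member, NO local type, NO `μ`-invariant and NO Iwasawa theory.  For the 18 anchored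
X4 Elkies-corner targets this REPLACES the chain (A⋆) + (T-μ) + (Kμ-K) of T-X4E by: A161″ (tree) on the anchor +
(V-rig) + 3-parity; census test C-rig0 (`x4e/x4e_rig0.gp`, kit j161347): `W(ℚ_ℓ)[3] = 0` at every additive `ℓ ≠ 3`
of `W` or `W₃`, `3 ∤ c_ℓ(W₃)` for `ℓ ≠ 3`, `w(W) = +1`.  Hypotheses as in `SelmerRigidityCertificate`. -/
@[conjecture] def SelmerRigidityCertificateZero : Prop :=
  ∀ (W W₃ : WeierstrassCurve ℚ) [W.IsElliptic] [W₃.IsElliptic] [W.IsGloballyMinimal] [W₃.IsGloballyMinimal],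
    W.HasIrreducibleModPGaloisRep 3 → ModPCongruent W W₃ 3 →
    torsionPoints W ℚ_[3] 3 = ⊥ →
    (∀ (ℓ : ℕ) [Fact ℓ.Prime], ℓ ≠ 3 → ¬ 3 ∣ (W₃.baseChange ℚ_[ℓ]).localTamagawaNumber ℤ_[ℓ]) →
    (∀ (ℓ : ℕ) [Fact ℓ.Prime], ℓ ≠ 3 → W.HasMultiplicativeReductionAtPrime ℓ →
      ¬ 3 ∣ (W.baseChange ℚ_[ℓ]).localTamagawaNumber ℤ_[ℓ]) →
    (∀ (ℓ : ℕ) [Fact ℓ.Prime], ℓ ≠ 3 →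
      ((¬ W.HasGoodReductionAtPrime ℓ ∧ ¬ W.HasMultiplicativeReductionAtPrime ℓ) ∨
       (¬ W₃.HasGoodReductionAtPrime ℓ ∧ ¬ W₃.HasMultiplicativeReductionAtPrime ℓ)) →
      torsionPoints W ℚ_[ℓ] 3 = ⊥) →
    ¬ 3 ∣ W₃.torsionOrder → (∀ s : W₃.sha, (3 : ℕ) • s = 0 → s = 0) →
    (W₃.mordellWeilRank = 0 ∨ (W₃.mordellWeilRank = 1 ∧ ∃ (x y : ℚ), W₃.toAffine.Nonsingular x y ∧
        GeneratesModTorsionUpToThree W₃ x y ∧ LocallyIndivisibleByThree W₃ x y)) →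
    W.rootNumber = 1 →
    W.mordellWeilRank = 0 ∧ ∀ s : W.sha, (3 : ℕ) • s = 0 → s = 0

/-- EVIDENCE: **theorem-candidate (elementary given the inputs named; o6-r1 GEN 22 ADDENDUM 7; NOT in print as stated; not
reviewed — audit AUD-20 (vi))** — **(T-X4E-rig-q) the TWO-PLACE SELMER RIGIDITY CERTIFICATE** for a `t = 0` target that is ADDITIVE at a
second prime `q ≠ 3` with `W(ℚ_q)[3] ≠ 0` (then `q` is of type IV or IV*, `3 ∣ c_q(W)`, and the Kummer line `κ_q(W) ⊂ H¹(ℚ_q, W[3])` is the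
RAMIFIED isotropic line: `W(ℚ_q)[3^∞] ↪ Φ_q(𝔽_q) ≅ ℤ/3` because `W⁰(ℚ_q)` has no 3-torsion, and `W(ℚ_q^{ur})/3 ≅ Φ_q(𝔽̄_q)/3 ≅ ℤ/3` is generated
by the 3-torsion point), while the congruent members that are good or multiplicative at `q` with `3 ∤ c_q` have `κ_q = H¹_{ur}`.  Compare
conditions away from `{3, q}`: `H := H¹(ℚ₃) ⊕ H¹(ℚ_q)` has dimension `2 + 2`, the image `V` of the away-from-`{3,q}` Selmer classes is
LAGRANGIAN (Poitou–Tate count as in (V-rig)), `L(W′) := κ₃(W′) ⊕ κ_q(W′)` is Lagrangian for every member, and `Sel₃(W′) ≅ S_str ⊕ (V ∩ L(W′))`.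
A Sel-trivial (or Kolyvagin rank-one) member `W₃` gives `S_str = 0`; a member `W₂` NOT additive at `q`, `3 ∤ c_q(W₂)`, of rank `≥ 2`
(then `V = L(W₂)`) OR merely carrying a rational point `P ∉ 3 W₂(ℚ_q)` (then `κ(P) ∈ V` has `q`-component in `κ_q(W₂) ∖ 0`,
`κ_q(W₂) = H¹_{ur}`, `H¹_{ur} ∩ κ_q(W) = 0`) shows `V ≠ L(W) := κ₃(W) ⊕ κ_q(W)`, so `dim Sel₃(W) = dim (V ∩ L(W)) ≤ 1`, and 3-parity
(`w(W) = +1`, `W(ℚ)[3] = 0`, Cassels–Tate) [cite: DokchitserDokchitserAnnals2010, Thm. 1.4] gives `Sel₃(W) = 0`.  (If `W(ℚ_q)[3] = 0` the place `q`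
is vacuous and this is `SelmerRigidityCertificateZero`.)  Aimed at the two C-rig0-excluded Elkies targets 388800ho1 / 388800ii1 (`q = 5`, IV*,
`c₅ = 3`); census Q-rig-5: `x4e/x4e_rig5_hunt.gp` (kit j161492: 7840 family members, no rank-2 member with points found), `x4e_rig5_cremona.gp` (j161565:
the 3 rank-2 congruent Cremona curves 287040y1/y2, 336960bh1 all carry `3 ∣ c₁₃` — as (V-rig) predicts), `x4e_rig5_k1.gp` (j161717: rank-≥1
members with a 5-adically indivisible point). -/
@[conjecture] def SelmerRigidityCertificateTwoPlace : Prop :=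
  ∀ (W W₂ W₃ : WeierstrassCurve ℚ) (q : ℕ) [Fact q.Prime] [W.IsElliptic] [W₂.IsElliptic] [W₃.IsElliptic]
    [W.IsGloballyMinimal] [W₂.IsGloballyMinimal] [W₃.IsGloballyMinimal],
    q ≠ 3 → W.HasIrreducibleModPGaloisRep 3 → ModPCongruent W W₂ 3 → ModPCongruent W W₃ 3 →
    torsionPoints W ℚ_[3] 3 = ⊥ →
    (¬ W.HasGoodReductionAtPrime q ∧ ¬ W.HasMultiplicativeReductionAtPrime q) → torsionPoints W ℚ_[q] 3 ≠ ⊥ →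
    (W₂.HasGoodReductionAtPrime q ∨ W₂.HasMultiplicativeReductionAtPrime q) →
    (∀ (ℓ : ℕ) [Fact ℓ.Prime], ℓ ≠ 3 →
      ¬ 3 ∣ (W₂.baseChange ℚ_[ℓ]).localTamagawaNumber ℤ_[ℓ] ∧ ¬ 3 ∣ (W₃.baseChange ℚ_[ℓ]).localTamagawaNumber ℤ_[ℓ]) →
    (∀ (ℓ : ℕ) [Fact ℓ.Prime], ℓ ≠ 3 → W.HasMultiplicativeReductionAtPrime ℓ →
      ¬ 3 ∣ (W.baseChange ℚ_[ℓ]).localTamagawaNumber ℤ_[ℓ]) →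
    (∀ (ℓ : ℕ) [Fact ℓ.Prime], ℓ ≠ 3 → ℓ ≠ q →
      ((¬ W.HasGoodReductionAtPrime ℓ ∧ ¬ W.HasMultiplicativeReductionAtPrime ℓ) ∨
       (¬ W₂.HasGoodReductionAtPrime ℓ ∧ ¬ W₂.HasMultiplicativeReductionAtPrime ℓ) ∨
       (¬ W₃.HasGoodReductionAtPrime ℓ ∧ ¬ W₃.HasMultiplicativeReductionAtPrime ℓ)) →
      torsionPoints W ℚ_[ℓ] 3 = ⊥) →
    ¬ 3 ∣ W₃.torsionOrder → (∀ s : W₃.sha, (3 : ℕ) • s = 0 → s = 0) →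
    (W₃.mordellWeilRank = 0 ∨ (W₃.mordellWeilRank = 1 ∧ ∃ (x y : ℚ), W₃.toAffine.Nonsingular x y ∧
        GeneratesModTorsionUpToThree W₃ x y ∧ LocallyIndivisibleByThree W₃ x y)) →
    (2 ≤ W₂.mordellWeilRank ∨ ∃ (x y : ℚ), W₂.toAffine.Nonsingular x y ∧ LocallyIndivisibleByThreeAt W₂ q x y) →
    W.rootNumber = 1 →
    W.mordellWeilRank = 0 ∧ ∀ s : W.sha, (3 : ℕ) • s = 0 → s = 0

/-! ### Certificate instances (EVIDENCE: computation, o6-r1 GEN 22 ADDENDUM 4; kit j160739, j160943, j161046, j161047)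

The data below instantiate every hypothesis of `SelmerRigidityCertificate` for the two t = 1 targets.
All congruences `W[3] ≅ E[3]` are certified by membership in Fisher's families `X_E(3)`, `X_E⁻(3)`
[cite: Fisher2012Hessian, Thm. 1.1] at the stated `(λ : μ)` (kit j161254: each named curve IS the rational point's
member up to equality of reduced minimal models; `77760s1 = X_E(3)(50:1)`); flex-image types are 40-digit 3-adic computations;
generators are Cremona's (canonical height = Cremona's regulator) and are 3-adically indivisible by 3.

* `E = 388800ij1`: `W₃ = 2880r5 = X_E(3)(0:1)` — rank 1, torsion `ℤ/4`, `c = (4,4,2)`, `g = (−130, 4032)`,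
  `Ш(2880r5) = 0` is a theorem in print [cite: Miller2011LMS, Thm. 1.2] (`N < 5000`, rank `≤ 1`, `E[3]`
  irreducible ⇒ BSD(E,3); `#Ш_an = 1`); `W₂ = 77760s1 = X_E(3)(50:1)` — rank 2, points `(−18,1440)`, `(142,800)`,
  `c = (4,3,5)`; types `ℓ(E) = ⟨3u⟩`, `ℓ(W₂) = ⟨3u²⟩` (distinct lines); `E(ℚ₂)[3] = E(ℚ₅)[3] = 0`.
* `E = 388800ha1`: `W₃ = 14400eb1 = X_E(3)(−27:2)` — rank 1, trivial torsion, `c = (1,2,1)`, `g = (−1,27)`,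
  `Ш(14400eb1)[3] = 0` by Kolyvagin [cite: Miller2011LMS, Thm. 4.4] with `K = ℚ(√−191)`: Heegner index
  `I_K² = ĥ(y_K)/ĥ(g) = 16` from Gross–Zagier–Zhang [cite: Miller2011LMS, Thm. 4.1] (normalisation checked on
  `2880r5`: `I_K² = 1024 = (∏ c_q)²`); the Manin constant `c = 1` of the optimal curve of the class is LOAD-BEARING
  here (Mazur's `p ∣ c ⇒ p² ∣ 4N` does not exclude `3` since `9 ∣ 14400`) and is Cremona's verification for all
  optimal curves of conductor `< 130000` as quoted in print [cite: Miller2011LMS, §4 ¶1]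
  [cite: AgasheRibetStein2006, §2 (Cremona's verification c = 1 for optimal curves, N < 130000; reached through Miller's §4 ¶1)]
  (lit-kato GEN 38, AUD-20 (iii)); `W₂ = 43200ff1 = X_E(3)(−12:1)` — rank 2, points `(26,96)`, `(−6,32)`,
  `c = (4,3,1)`; types `ℓ(E) = ⟨3u⟩`, `ℓ(W₂) = ⟨u⟩`; `E(ℚ₂)[3] = E(ℚ₅)[3] = 0`.

With `L(E,1)/Ω_E = 3` (both targets, exact) the conclusion `Ш(E)[3^∞] = 0` gives `v₃(#Ш) + v₃(∏c_ℓ) = 1 =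
v₃(L/Ω)`, i.e. BSD(E,3) and in particular `MissingUpperBoundAt E 3`. -/

/-- Cremona `2880r5` (Kolyvagin member `W₃` for `388800ij1`; BSD known [cite: Miller2011LMS, Thm. 1.2]). [folklore] -/
def curve2880r5 : WeierstrassCurve ℚ := ⟨0, 0, 0, -77772, 8343664⟩

/-- Cremona `77760s1` (rank-two member `W₂` for `388800ij1`, flex type `⟨3u²⟩`). [folklore] -/
def curve77760s1 : WeierstrassCurve ℚ := ⟨0, 0, 0, -26892, 1595376⟩

/-- Cremona `14400eb1` (Kolyvagin member `W₃` for `388800ha1`; `I_{ℚ(√−191)}² = 16`). [folklore] -/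
def curve14400eb1 : WeierstrassCurve ℚ := ⟨0, 0, 0, 60, 790⟩

/-- Cremona `43200ff1` (rank-two member `W₂` for `388800ha1`, flex type `⟨u⟩`). [folklore] -/
def curve43200ff1 : WeierstrassCurve ℚ := ⟨0, 0, 0, -300, -560⟩

end X4Erig

/-! ## §Readings (typer's bookkeeping, cc-typer-5 GEN 16; PROVED) — the certificates in the cell's currency

The common conclusion of T-X4E-rig / T-X4E-rig-0 / T-X4E-rig-q is `rank W(ℚ) = 0 ∧ Ш(W/ℚ)[3] = 0`.  At a pair with
`3 ∤ #Ш_an(W)` (both `t = 1` targets: `#Ш_an = 1`, `L(E,1)/Ω_E = 3 = c₃`, memo ADDENDUM 4; all 20 O6 ∧ r0 Elkies pairs have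
`#Ш_an ∈ {1, 4, 25}`) the tree's finite-certificate currency (`Typed/KolyvaginCertificate.lean`) turns `Ш(W)[3] = 0` into the
WHOLE missing `3`-part `MissingPPartAt W 3` (finite `Ш`) and, granted Gross–Zagier–Kolyvagin (`hGZK`, bsd.S17) in analytic rank
`≤ 1`, into Miller's `BSDp W 3`.  The certificate targets enter ONLY as displayed binders (`hX`, `hX₀`); nothing is asserted about
them and no per-curve statement is made. -/

section Readings

/-- `Ш(W)[3] = 0` in the certificates' spelling (`(3 : ℕ) • s = 0 → s = 0`) gives the tree's spelling
(`((3 : ℕ) : ℤ) • x = 0 → x = 0`). Bookkeeping. [folklore] -/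
theorem noThreeTorsion_int_of_nat {W : WeierstrassCurve ℚ}
    (h : ∀ s : W.sha, (3 : ℕ) • s = 0 → s = 0) :
    ∀ x : W.sha, ((3 : ℕ) : ℤ) • x = 0 → x = 0 := fun x hx =>
  h x (by rwa [natCast_zsmul] at hx)

/-- **The certificates' conclusion ⇒ the whole missing `3`-part** at a pair with finite `Ш` and `3 ∤ #Ш_an(W)`
(`#Ш_an(W) = q`, `ord₃ q = 0`).  Bookkeeping over `Typed.missingPPartAt_of_shaAn_unit_of_noPTorsion`.
[cite: Miller2011LMS, §1 and Def. 1.1] -/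
theorem missingPPartAt_three_of_rankZero_noThreeTorsion {W : WeierstrassCurve ℚ}
    (hc : W.mordellWeilRank = 0 ∧ ∀ s : W.sha, (3 : ℕ) • s = 0 → s = 0)
    (hfin : W.ShaFinite) {q : ℚ} (hq : shaAn W = (q : ℂ)) (hunit : padicValRat 3 q = 0) :
    MissingPPartAt W 3 :=
  missingPPartAt_of_shaAn_unit_of_noPTorsion W 3 hfin hq hunit (noThreeTorsion_int_of_nat hc.2)

/-- **The certificates' conclusion ⇒ Miller's `BSD(W,3)`** in analytic rank `≤ 1` at a pair with `3 ∤ #Ш_an(W)`, granted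
Gross–Zagier–Kolyvagin (`hGZK`, bsd.S17: `rank = r_an`, `Ш` finite).  Bookkeeping over `Typed.bsdp_of_shaAn_unit_of_noPTorsion`.
[cite: Miller2011LMS, §1 and Def. 1.1] [cite: Darmon2004, Thm. 3.22] -/
theorem bsdp_three_of_rankZero_noThreeTorsion (hGZK : rank_eq_analyticRank_of_analyticRank_le_one)
    {W : WeierstrassCurve ℚ} [W.IsElliptic]
    (hc : W.mordellWeilRank = 0 ∧ ∀ s : W.sha, (3 : ℕ) • s = 0 → s = 0)
    (hr : W.analyticRank ≤ 1) {q : ℚ} (hq : shaAn W = (q : ℂ)) (hunit : padicValRat 3 q = 0) :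
    BSDp W 3 :=
  bsdp_of_shaAn_unit_of_noPTorsion W 3 hGZK hr hq hunit (noThreeTorsion_int_of_nat hc.2)

/-- **T-X4E-rig in the cell's currency** (the `t = 1` targets' socket): granted the certificate target
`hX : SelmerRigidityCertificate` with EVERY hypothesis displayed for `(W, W₂, W₃)`, GZK, analytic rank `≤ 1` and
`#Ш_an(W) = q` with `ord₃ q = 0`, Miller's `BSD(W,3)`.  Nothing asserted about `hX`. [cite: Miller2011LMS, §1 and Def. 1.1] -/
theorem bsdp_three_of_selmerRigidityCertificate (hX : SelmerRigidityCertificate)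
    (hGZK : rank_eq_analyticRank_of_analyticRank_le_one)
    (W W₂ W₃ : WeierstrassCurve ℚ) [W.IsElliptic] [W₂.IsElliptic] [W₃.IsElliptic]
    [W.IsGloballyMinimal] [W₂.IsGloballyMinimal] [W₃.IsGloballyMinimal]
    (hirr : W.HasIrreducibleModPGaloisRep 3) (h₂ : ModPCongruent W W₂ 3) (h₃ : ModPCongruent W W₃ 3)
    (ht3 : Nat.card (torsionPoints W ℚ_[3] 3) = 3)
    (htam : ∀ (ℓ : ℕ) [Fact ℓ.Prime], ℓ ≠ 3 →
      ¬ 3 ∣ (W.baseChange ℚ_[ℓ]).localTamagawaNumber ℤ_[ℓ] ∧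
      ¬ 3 ∣ (W₂.baseChange ℚ_[ℓ]).localTamagawaNumber ℤ_[ℓ] ∧
      ¬ 3 ∣ (W₃.baseChange ℚ_[ℓ]).localTamagawaNumber ℤ_[ℓ])
    (hadd : ∀ (ℓ : ℕ) [Fact ℓ.Prime], ℓ ≠ 3 →
      ((¬ W.HasGoodReductionAtPrime ℓ ∧ ¬ W.HasMultiplicativeReductionAtPrime ℓ) ∨
        (¬ W₂.HasGoodReductionAtPrime ℓ ∧ ¬ W₂.HasMultiplicativeReductionAtPrime ℓ) ∨
        (¬ W₃.HasGoodReductionAtPrime ℓ ∧ ¬ W₃.HasMultiplicativeReductionAtPrime ℓ)) →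
      torsionPoints W ℚ_[ℓ] 3 = ⊥)
    (htors₃ : ¬ 3 ∣ W₃.torsionOrder) (hsha₃ : ∀ s : W₃.sha, (3 : ℕ) • s = 0 → s = 0)
    (hrk₃ : W₃.mordellWeilRank = 0 ∨
      (W₃.mordellWeilRank = 1 ∧ ∃ (x y : ℚ), W₃.toAffine.Nonsingular x y ∧
        GeneratesModTorsionUpToThree W₃ x y ∧ LocallyIndivisibleByThree W₃ x y))
    (hrk₂ : 2 ≤ W₂.mordellWeilRank)
    (hW : ¬ FlexImageTrivialAtThree W) (hW₂ : ¬ FlexImageTrivialAtThree W₂)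
    (hWf : ¬ FlexImageFullAtThree W) (hW₂f : ¬ FlexImageFullAtThree W₂)
    (hdis : FlexImagesDisjointAtThree W W₂)
    (hr : W.analyticRank ≤ 1) {q : ℚ} (hq : shaAn W = (q : ℂ)) (hunit : padicValRat 3 q = 0) :
    BSDp W 3 :=
  bsdp_three_of_rankZero_noThreeTorsion hGZK
    (hX W W₂ W₃ hirr h₂ h₃ ht3 htam hadd htors₃ hsha₃ hrk₃ hrk₂ hW hW₂ hWf hW₂f hdis) hr hq hunit

/-- **T-X4E-rig-0 in the cell's currency** (the 18 anchored `t = 0` Elkies-corner targets' socket): granted the certificate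
target `hX₀ : SelmerRigidityCertificateZero` with every hypothesis displayed for `(W, W₃)`, GZK, analytic rank `≤ 1` and
`#Ш_an(W) = q` with `ord₃ q = 0`, Miller's `BSD(W,3)`.  Nothing asserted about `hX₀`. [cite: Miller2011LMS, §1 and Def. 1.1] -/
theorem bsdp_three_of_selmerRigidityCertificateZero (hX₀ : SelmerRigidityCertificateZero)
    (hGZK : rank_eq_analyticRank_of_analyticRank_le_one)
    (W W₃ : WeierstrassCurve ℚ) [W.IsElliptic] [W₃.IsElliptic] [W.IsGloballyMinimal] [W₃.IsGloballyMinimal]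
    (hirr : W.HasIrreducibleModPGaloisRep 3) (h₃ : ModPCongruent W W₃ 3)
    (ht0 : torsionPoints W ℚ_[3] 3 = ⊥)
    (htam₃ : ∀ (ℓ : ℕ) [Fact ℓ.Prime], ℓ ≠ 3 → ¬ 3 ∣ (W₃.baseChange ℚ_[ℓ]).localTamagawaNumber ℤ_[ℓ])
    (htam : ∀ (ℓ : ℕ) [Fact ℓ.Prime], ℓ ≠ 3 → W.HasMultiplicativeReductionAtPrime ℓ →
      ¬ 3 ∣ (W.baseChange ℚ_[ℓ]).localTamagawaNumber ℤ_[ℓ])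
    (hadd : ∀ (ℓ : ℕ) [Fact ℓ.Prime], ℓ ≠ 3 →
      ((¬ W.HasGoodReductionAtPrime ℓ ∧ ¬ W.HasMultiplicativeReductionAtPrime ℓ) ∨
       (¬ W₃.HasGoodReductionAtPrime ℓ ∧ ¬ W₃.HasMultiplicativeReductionAtPrime ℓ)) →
      torsionPoints W ℚ_[ℓ] 3 = ⊥)
    (htors₃ : ¬ 3 ∣ W₃.torsionOrder) (hsha₃ : ∀ s : W₃.sha, (3 : ℕ) • s = 0 → s = 0)
    (hrk₃ : W₃.mordellWeilRank = 0 ∨ (W₃.mordellWeilRank = 1 ∧ ∃ (x y : ℚ), W₃.toAffine.Nonsingular x y ∧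
        GeneratesModTorsionUpToThree W₃ x y ∧ LocallyIndivisibleByThree W₃ x y))
    (hw : W.rootNumber = 1)
    (hr : W.analyticRank ≤ 1) {q : ℚ} (hq : shaAn W = (q : ℂ)) (hunit : padicValRat 3 q = 0) :
    BSDp W 3 :=
  bsdp_three_of_rankZero_noThreeTorsion hGZK
    (hX₀ W W₃ hirr h₃ ht0 htam₃ htam hadd htors₃ hsha₃ hrk₃ hw) hr hq hunit

/-! ### Exact arithmetic on the instance records (C-rig-2's four points and the two Kolyvagin generators lie on the
displayed models; `norm_num`).  Records of the instrument reading, kernel-checked; O6 OPEN; not a Literature fact. -/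

/-- Cremona's generator `(−130, 4032)` lies on the model `curve2880r5`. [folklore] -/
theorem curve2880r5_equation : curve2880r5.toAffine.Equation (-130) 4032 := by
  rw [WeierstrassCurve.Affine.equation_iff]; norm_num [curve2880r5]

/-- The points `(−18, 1440)` and `(142, 800)` (C-rig-2) lie on the model `curve77760s1`. [folklore] -/
theorem curve77760s1_equation :
    curve77760s1.toAffine.Equation (-18) 1440 ∧ curve77760s1.toAffine.Equation 142 800 := by
  constructor <;> (rw [WeierstrassCurve.Affine.equation_iff]; norm_num [curve77760s1])

/-- Cremona's generator `(−1, 27)` lies on the model `curve14400eb1`. [folklore] -/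
theorem curve14400eb1_equation : curve14400eb1.toAffine.Equation (-1) 27 := by
  rw [WeierstrassCurve.Affine.equation_iff]; norm_num [curve14400eb1]

/-- The points `(26, 96)` and `(−6, 32)` (C-rig-2) lie on the model `curve43200ff1`. [folklore] -/
theorem curve43200ff1_equation :
    curve43200ff1.toAffine.Equation 26 96 ∧ curve43200ff1.toAffine.Equation (-6) 32 := by
  constructor <;> (rw [WeierstrassCurve.Affine.equation_iff]; norm_num [curve43200ff1])

end Readings

end Summit.BirchSwinnertonDyer.Rank1Residual.O6

end
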